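import Summits.ResolutionOfSingularities.ResolutionOfSingularities.Theorems.HilbertSamuelEliminationSigmaMaxModificationsCorridor3WLadderRecognitionNearLocusShape
import Summits.ResolutionOfSingularities.ResolutionOfSingularities.Theorems.HilbertSamuelEliminationCampaignW42NearPointRationalBinder
import Literature.AlgebraicGeometry.CossartJannsenSaito2020.ProjDirProjectiveLine
import HarnessLib

/-!
# [OURS · L1 W4.2] RECOGNITION-GEOMETRY (R2), PART 4: THE KEYED FORMS — every binder BY NAME, and stub-1's shapes (Dich)/(RegN)
# (crux chain w42, line `w_ladder`; `--supports stmt-…-19249`, helper)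

OURS (cell res-hironaka, slot W4.2, seat res-L1-w42-stub-2 gen 4); NOT statements of H. Hironaka's manuscript [Hironaka2017]
nor of [CossartJannsenSaito2020]. AI-drafted, weaker than expert review. Sorry-free PROOF file (no new definition).

PARTS 1–3 (`…RecognitionNearLocusFibres` / `…Curve` / `…Shape`) carry two hypotheses BY SHAPE; both are now in the tree BY NAME:
* `hT36` := the named fact **`CossartJannsenSaito2020_thm_3_6`** (F-65, `Literature/…/CossartJannsenSaito2020/DirectrixSemicontinuity.lean`,
  res-type-064; discharged from CJS Thm. 3.7 + Thm. 3.2 (3) + Matsumura 29.4 (ii) in `…/DirectrixSemicontinuityProof.lean`) — the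
  shape is that definition unfolded, so it is passed verbatim;
* `hPb` := **`CampaignW42.isIso_residueFieldMap_of_near_of_charHypothesis h314pt`** (res-L1-s42-pv-1's P-b binder F-D,
  `…CampaignW42NearPointRationalBinder.lean`, p522235) from the printed CJS Thm. 3.14 point-locus fact `Thm314_point_locus`.

So the (R2) outputs hold MODULO PRINTED FACTS ONLY: `CossartJannsenSaito2020_thm_3_10_4` (h3104), `CossartJannsenSaito2020_thm_3_14`
(h314), `Thm314_nearFibre_subsingleton` (h314f), `Thm314_point_locus` (h314pt), `CossartJannsenSaito2020_thm_3_6` (h36). This file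
records the keyed forms, and the two shapes stub-1's (R5)/(H-emp) label calculus consumes (its FINDING 2026-08-27T10:16:13Z):
**(Dich) `IsIrreducible N ∨ N.Finite`** and **(RegN) `N.Infinite → Scheme.IsRegular (vanishingIdeal ⟨N, _⟩).subscheme`** for the near
locus `N = N_{j+1}(x)` over a curve centre, plus `inducesIsoOn_nearLocus_succ_of_infinite` and the keyed Def. 6.38 (iv) along the unit.
APPENDED: the BASE of the induction from P-a — `curveData_projDir (hPa : ProjDir_projLine)` (`ℙ(Dir_x) ≅ ℙ¹` is closed,
irreducible, nontrivial, non-generic points closed), and the unit-level statements keyed with P-a and (R1) `C_1 = T.projDir x`: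
**`inducesIsoOn_of_centres_eq_nearLocus_projDir`** (Def. 6.38 (iv) for all `1 ≤ j`, `j + 1 ≤ q`) and
**`dich_and_regN_of_centres_eq_nearLocus_projDir`** ((Dich)/(RegN) at every stage `≤ q + 1`).

## References

* V. Cossart, U. Jannsen, S. Saito, LNM 2270 (2020): Thm. 3.6, Thm. 3.10, Thm. 3.14, Def. 6.38 (iii)–(v), proof of Thm. 6.28 Step 2
  (p. 94), p. 104. [CossartJannsenSaito2020]
-/

noncomputable section

-- namespace `…Corridor3.Helpers` re-enters `…Corridor3`
set_option linter.dupNamespace false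

open CategoryTheory AlgebraicGeometry TopologicalSpace IsLocalRing
open Literature.AlgebraicGeometry.Resolution
open Scheme.IdealSheafData

universe u

open Literature.AlgebraicGeometry.CossartJannsenSaito2020

namespace Summit.ResolutionOfSingularities.ResolutionOfSingularities.Theorems.SigmaMaxModificationsCorridor3.Helpers

namespace BlowupTowerNear

variable {T : BlowupTower.{u}} {N : ℕ}

/-- **(Dich) for stub-1: `N_{j+1}(x)` is irreducible or finite** (standing hypotheses of PART 1 at stage `j`, `X_0` noetherian).
[cite: CossartJannsenSaito2020, p. 94, p. 104] -/
theorem isIrreducible_or_finite_nearLocus_succ [IsNoetherian (T.X 0)] (h314f : Thm314_nearFibre_subsingleton.{u})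
    (h36 : CossartJannsenSaito2020_thm_3_6.{u}) (h3104 : CossartJannsenSaito2020_thm_3_10_4.{u}) (hkey : KeySetting T N)
    (hperm : ∀ j, IdealSheafData.IsPermissible (T.centreIdeal j))
    (hcl : ∀ (j : ℕ) (μ : ℕ → ℕ), IsClosed (Scheme.hsStratumGE (T.X j) N μ))
    {x : T.X 0} (hx : IsClosed ({x} : Set (T.X 0))) (hchar : CharHypothesis (T.X 0) x) (hē : T.geomDirDimAt 0 x ≤ 2) {j : ℕ}
    (hNC : ∀ i, i ≤ j → T.nearLocus N x i ⊆ T.C i) (hCN : T.C j ⊆ T.nearLocus N x j)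
    (hirr : IsIrreducible (T.C j)) (hnt : (T.C j).Nontrivial)
    (hpts : ∀ y ∈ T.C j, ¬ IsGenericPoint y (T.C j) → IsClosed ({y} : Set (T.X j))) :
    IsIrreducible (T.nearLocus N x (j + 1)) ∨ (T.nearLocus N x (j + 1)).Finite := by
  have hη : IsGenericPoint hirr.genericPoint (T.C j) := hirr.isGenericPoint_genericPoint (T.isClosed_C j)
  rcases nearLocus_succ_finite_or_dominant h314f h36 h3104 hkey hperm hcl hx hchar hē hNC hCN hirr hnt hpts hη with hF | hdom
  · exact Or.inr hF
  · exact Or.inl (isIrreducible_nearLocus_succ_of_dominant h314f h36 h3104 hkey hperm hcl hx hchar hē hNC hCN hirr hnt hpts hη hdom)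

/-- An INFINITE near locus is dominant. [cite: CossartJannsenSaito2020, p. 94] -/
theorem dominant_of_infinite [IsNoetherian (T.X 0)] (h314f : Thm314_nearFibre_subsingleton.{u})
    (h36 : CossartJannsenSaito2020_thm_3_6.{u}) (h3104 : CossartJannsenSaito2020_thm_3_10_4.{u}) (hkey : KeySetting T N)
    (hperm : ∀ j, IdealSheafData.IsPermissible (T.centreIdeal j))
    (hcl : ∀ (j : ℕ) (μ : ℕ → ℕ), IsClosed (Scheme.hsStratumGE (T.X j) N μ))
    {x : T.X 0} (hx : IsClosed ({x} : Set (T.X 0))) (hchar : CharHypothesis (T.X 0) x) (hē : T.geomDirDimAt 0 x ≤ 2) {j : ℕ}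
    (hNC : ∀ i, i ≤ j → T.nearLocus N x i ⊆ T.C i) (hCN : T.C j ⊆ T.nearLocus N x j)
    (hirr : IsIrreducible (T.C j)) (hnt : (T.C j).Nontrivial)
    (hpts : ∀ y ∈ T.C j, ¬ IsGenericPoint y (T.C j) → IsClosed ({y} : Set (T.X j)))
    {η : T.X j} (hη : IsGenericPoint η (T.C j)) (hinf : (T.nearLocus N x (j + 1)).Infinite) :
    η ∈ (T.π j).base '' T.nearLocus N x (j + 1) := by
  rcases nearLocus_succ_finite_or_dominant h314f h36 h3104 hkey hperm hcl hx hchar hē hNC hCN hirr hnt hpts hη with hF | hdom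
  · exact absurd hF hinf
  · exact hdom

/-- **`κ(η_j) = κ(η_{j+1})`, KEYED** (PART 2 `isIso_residueFieldMap_of_mem_nearLocus_succ` with `hPb` := res-L1-s42-pv-1's
`CampaignW42.isIso_residueFieldMap_of_near_of_charHypothesis h314pt` and `hT36 := h36`). [cite: CossartJannsenSaito2020, Thm. 3.14, p. 104] -/
theorem isIso_residueFieldMap_of_mem_nearLocus_succ_keyed (h314pt : Thm314_point_locus.{u})
    (h314 : CossartJannsenSaito2020_thm_3_14.{u}) (h36 : CossartJannsenSaito2020_thm_3_6.{u})
    (h3104 : CossartJannsenSaito2020_thm_3_10_4.{u}) (hkey : KeySetting T N)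
    (hperm : ∀ j, IdealSheafData.IsPermissible (T.centreIdeal j))
    {x : T.X 0} (hchar : CharHypothesis (T.X 0) x) (hē : T.geomDirDimAt 0 x ≤ 2) {j : ℕ}
    (hNC : ∀ i, i ≤ j → T.nearLocus N x i ⊆ T.C i) (hCN : T.C j ⊆ T.nearLocus N x j)
    (hirr : IsIrreducible (T.C j)) (hnt : (T.C j).Nontrivial)
    (hpts : ∀ y ∈ T.C j, ¬ IsGenericPoint y (T.C j) → IsClosed ({y} : Set (T.X j)))
    {z : T.X (j + 1)} (hz : z ∈ T.nearLocus N x (j + 1)) (hgen : IsGenericPoint ((T.π j).base z) (T.C j)) :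
    IsIso ((T.π j).residueFieldMap z) :=
  isIso_residueFieldMap_of_mem_nearLocus_succ (CampaignW42.isIso_residueFieldMap_of_near_of_charHypothesis h314pt) h314 h36
    h3104 hkey hperm hchar hē hNC hCN hirr hnt hpts hz hgen

/-- **(RegN) for stub-1: an INFINITE `N_{j+1}(x)` is, with its reduced structure, REGULAR** — KEYED (printed facts only).
[cite: CossartJannsenSaito2020, Def. 6.38 (iv), p. 94] -/
theorem isRegular_nearLocus_succ_of_infinite [IsNoetherian (T.X 0)] (h314pt : Thm314_point_locus.{u})
    (h314 : CossartJannsenSaito2020_thm_3_14.{u}) (h314f : Thm314_nearFibre_subsingleton.{u})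
    (h36 : CossartJannsenSaito2020_thm_3_6.{u}) (h3104 : CossartJannsenSaito2020_thm_3_10_4.{u}) (hkey : KeySetting T N)
    (hperm : ∀ j, IdealSheafData.IsPermissible (T.centreIdeal j))
    (hcl : ∀ (j : ℕ) (μ : ℕ → ℕ), IsClosed (Scheme.hsStratumGE (T.X j) N μ))
    {x : T.X 0} (hx : IsClosed ({x} : Set (T.X 0))) (hchar : CharHypothesis (T.X 0) x) (hē : T.geomDirDimAt 0 x ≤ 2) {j : ℕ}
    (hNC : ∀ i, i ≤ j → T.nearLocus N x i ⊆ T.C i) (hCN : T.C j ⊆ T.nearLocus N x j)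
    (hirr : IsIrreducible (T.C j)) (hnt : (T.C j).Nontrivial)
    (hpts : ∀ y ∈ T.C j, ¬ IsGenericPoint y (T.C j) → IsClosed ({y} : Set (T.X j)))
    (hinf : (T.nearLocus N x (j + 1)).Infinite) (hN : IsClosed (T.nearLocus N x (j + 1))) :
    Scheme.IsRegular (vanishingIdeal (⟨T.nearLocus N x (j + 1), hN⟩ : Closeds (T.X (j + 1)))).subscheme :=
  have hη : IsGenericPoint hirr.genericPoint (T.C j) := hirr.isGenericPoint_genericPoint (T.isClosed_C j)
  isRegular_nearLocus_succ_of_dominant (CampaignW42.isIso_residueFieldMap_of_near_of_charHypothesis h314pt) h314 h314f h36 h3104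
    hkey hperm hcl hx hchar hē hNC hCN hirr hnt hpts hη
    (dominant_of_infinite h314f h36 h3104 hkey hperm hcl hx hchar hē hNC hCN hirr hnt hpts hη hinf) hN

/-- **CJS Def. 6.38 (iv) at one step, KEYED: an INFINITE `N_{j+1}(x)` is mapped ISOMORPHICALLY onto `C_j` by `π_{j+1}`** (printed
facts only). [cite: CossartJannsenSaito2020, Def. 6.38 (iv), p. 104] -/
theorem inducesIsoOn_nearLocus_succ_of_infinite [IsNoetherian (T.X 0)] (h314pt : Thm314_point_locus.{u})
    (h314 : CossartJannsenSaito2020_thm_3_14.{u}) (h314f : Thm314_nearFibre_subsingleton.{u})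
    (h36 : CossartJannsenSaito2020_thm_3_6.{u}) (h3104 : CossartJannsenSaito2020_thm_3_10_4.{u}) (hkey : KeySetting T N)
    (hperm : ∀ j, IdealSheafData.IsPermissible (T.centreIdeal j))
    (hcl : ∀ (j : ℕ) (μ : ℕ → ℕ), IsClosed (Scheme.hsStratumGE (T.X j) N μ))
    {x : T.X 0} (hx : IsClosed ({x} : Set (T.X 0))) (hchar : CharHypothesis (T.X 0) x) (hē : T.geomDirDimAt 0 x ≤ 2) {j : ℕ}
    (hNC : ∀ i, i ≤ j → T.nearLocus N x i ⊆ T.C i) (hCN : T.C j ⊆ T.nearLocus N x j)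
    (hirr : IsIrreducible (T.C j)) (hnt : (T.C j).Nontrivial)
    (hpts : ∀ y ∈ T.C j, ¬ IsGenericPoint y (T.C j) → IsClosed ({y} : Set (T.X j)))
    (hinf : (T.nearLocus N x (j + 1)).Infinite) (hN : IsClosed (T.nearLocus N x (j + 1))) :
    InducesIsoOn (T.π j) (T.nearLocus N x (j + 1)) hN (T.C j) (T.isClosed_C j) :=
  have hη : IsGenericPoint hirr.genericPoint (T.C j) := hirr.isGenericPoint_genericPoint (T.isClosed_C j)
  inducesIsoOn_nearLocus_succ_of_dominant (CampaignW42.isIso_residueFieldMap_of_near_of_charHypothesis h314pt) h314 h314f h36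
    h3104 hkey hperm hcl hx hchar hē hNC hCN hirr hnt hpts hη
    (dominant_of_infinite h314f h36 h3104 hkey hperm hcl hx hchar hē hNC hCN hirr hnt hpts hη hinf) hN

/-- **CJS Def. 6.38 (iv) ALONG THE UNIT, KEYED** (`inducesIsoOn_of_centres_eq_nearLocus` with every binder by name): for a tower
with `C_0 = {x}`, `C_i = N_i(x)` (`1 ≤ i ≤ q`), `C_1` a curve, and a non-isolated closed near point at each stage `2 ≤ i ≤ q`,
`π_{j+1} : C_{j+1} ⥲ C_j` for all `1 ≤ j`, `j + 1 ≤ q` — modulo the printed facts h314pt, h314, h314f, h36, h3104 only.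
[cite: CossartJannsenSaito2020, Def. 6.38 (iv), p. 104] -/
theorem inducesIsoOn_of_centres_eq_nearLocus_keyed [IsNoetherian (T.X 0)] (h314pt : Thm314_point_locus.{u})
    (h314 : CossartJannsenSaito2020_thm_3_14.{u}) (h314f : Thm314_nearFibre_subsingleton.{u})
    (h36 : CossartJannsenSaito2020_thm_3_6.{u}) (h3104 : CossartJannsenSaito2020_thm_3_10_4.{u}) (hkey : KeySetting T N)
    (hperm : ∀ j, IdealSheafData.IsPermissible (T.centreIdeal j))
    (hcl : ∀ (j : ℕ) (μ : ℕ → ℕ), IsClosed (Scheme.hsStratumGE (T.X j) N μ))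
    {x : T.X 0} (hx : IsClosed ({x} : Set (T.X 0))) (hchar : CharHypothesis (T.X 0) x) (hē : T.geomDirDimAt 0 x ≤ 2)
    (hC0 : T.C 0 = {x}) {q : ℕ} (hCq : ∀ i, 1 ≤ i → i ≤ q → T.C i = T.nearLocus N x i)
    (h1irr : IsIrreducible (T.C 1)) (h1nt : (T.C 1).Nontrivial)
    (h1pts : ∀ y ∈ T.C 1, ¬ IsGenericPoint y (T.C 1) → IsClosed ({y} : Set (T.X 1)))
    (hniso : ∀ i, 2 ≤ i → i ≤ q → ∃ z ∈ T.nearLocus N x i, IsClosed ({z} : Set (T.X i)) ∧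
      ¬ ∃ U : Set (T.X i), IsOpen U ∧ U ∩ T.nearLocus N x i = {z}) :
    ∀ j, 1 ≤ j → j + 1 ≤ q → InducesIsoOn (T.π j) (T.C (j + 1)) (T.isClosed_C (j + 1)) (T.C j) (T.isClosed_C j) :=
  inducesIsoOn_of_centres_eq_nearLocus (CampaignW42.isIso_residueFieldMap_of_near_of_charHypothesis h314pt) h314 h314f h36 h3104
    hkey hperm hcl hx hchar hē hC0 hCq h1irr h1nt h1pts hniso

/-! ## Appended (gen 4): the base of the induction from P-a — `C_1 = ℙ(Dir_x(X_0)) ≅ ℙ¹_{κ(x)}` IS a curve -/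

/-- **The base case from P-a (`ProjDir_projLine`, CJS Def. 6.38 (ii) `C_1 ≅ ℙ¹_{k(x)}`)**: if `C_0 = {x}` with `x` closed and
`e_x(X_0) = 2`, then `T.projDir x = ℙ(Dir_x(X_0)) ⊆ X_1` is closed, irreducible, NONTRIVIAL, and its non-generic points are closed —
the «curve data» the one-step theorems of PARTS 1–3 start from (with (R1) `C_1 = T.projDir x`).
[cite: CossartJannsenSaito2020, Def. 6.38 (ii), Def. 6.34 (i), p. 103] -/
theorem curveData_projDir (hPa : ProjDir_projLine.{u}) {x : T.X 0} (hx : IsClosed ({x} : Set (T.X 0))) (hC0 : T.C 0 = {x})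
    (he : T.dirDimAt 0 x = 2) :
    IsClosed (T.projDir x) ∧ IsIrreducible (T.projDir x) ∧ (T.projDir x).Nontrivial ∧
      ∀ y ∈ T.projDir x, ¬ IsGenericPoint y (T.projDir x) → IsClosed ({y} : Set (T.X 1)) := by
  haveI : ∀ j, IsLocallyNoetherian (T.X j) := T.ln
  have hcl : (⟨T.C 0, T.isClosed_C 0⟩ : Closeds (T.X 0)) = ⟨{x}, hx⟩ := Closeds.ext hC0
  have hbl : IsBlowup (T.π 0) (vanishingIdeal (⟨{x}, hx⟩ : Closeds (T.X 0))) := by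
    have h := T.isBlowup 0
    rwa [hcl] at h
  obtain ⟨h1, h2, h3, h4, -⟩ := hPa (T.X 0) (T.X 1) (T.π 0) x hx hbl he
  refine ⟨h1, h2, ?_, h4⟩
  -- nontrivial: the generic point is not closed, so `ℙ(Dir)` is not the single point `{η}`
  have hη : IsGenericPoint h2.genericPoint (T.projDir x) := h2.isGenericPoint_genericPoint h1
  by_contra hnt
  have hsub : (T.projDir x).Subsingleton := fun a ha b hb => by
    by_contra hab; exact hnt ⟨a, ha, b, hb, hab⟩
  have heq : T.projDir x = {h2.genericPoint} := hsub.eq_singleton_of_mem hη.mem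
  exact h3 _ hη (by rw [← heq]; exact h1)

/-- **CJS Def. 6.38 (iv) ALONG THE UNIT, KEYED WITH P-a**: for a tower with `C_0 = {x}` (`x` closed, `e_x = 2`, `ē_x ≤ 2`, (F1)),
`C_1 = ℙ(Dir_x(X_0))` (R1), `C_i = N_i(x)` for `1 ≤ i ≤ q`, and a non-isolated closed near point at each stage `2 ≤ i ≤ q` (the marked
point at a non-`Iso` stage), **`π_{j+1} : C_{j+1} ⥲ C_j` for all `1 ≤ j`, `j + 1 ≤ q`** — the `iso` clause of `IsFundamentalUnit` /
`Seg.UnitCentreDiscipline` verbatim, modulo the printed facts h314pt, h314, h314f, h36, h3104 and P-a `ProjDir_projLine` only.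
[cite: CossartJannsenSaito2020, Def. 6.38 (ii)–(iv), p. 104] -/
theorem inducesIsoOn_of_centres_eq_nearLocus_projDir [IsNoetherian (T.X 0)] (hPa : ProjDir_projLine.{u})
    (h314pt : Thm314_point_locus.{u}) (h314 : CossartJannsenSaito2020_thm_3_14.{u}) (h314f : Thm314_nearFibre_subsingleton.{u})
    (h36 : CossartJannsenSaito2020_thm_3_6.{u}) (h3104 : CossartJannsenSaito2020_thm_3_10_4.{u}) (hkey : KeySetting T N)
    (hperm : ∀ j, IdealSheafData.IsPermissible (T.centreIdeal j))
    (hcl : ∀ (j : ℕ) (μ : ℕ → ℕ), IsClosed (Scheme.hsStratumGE (T.X j) N μ))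
    {x : T.X 0} (hx : IsClosed ({x} : Set (T.X 0))) (hchar : CharHypothesis (T.X 0) x) (he : T.dirDimAt 0 x = 2)
    (hē : T.geomDirDimAt 0 x ≤ 2) (hC0 : T.C 0 = {x}) (hC1 : T.C 1 = T.projDir x) {q : ℕ}
    (hCq : ∀ i, 1 ≤ i → i ≤ q → T.C i = T.nearLocus N x i)
    (hniso : ∀ i, 2 ≤ i → i ≤ q → ∃ z ∈ T.nearLocus N x i, IsClosed ({z} : Set (T.X i)) ∧
      ¬ ∃ U : Set (T.X i), IsOpen U ∧ U ∩ T.nearLocus N x i = {z}) :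
    ∀ j, 1 ≤ j → j + 1 ≤ q → InducesIsoOn (T.π j) (T.C (j + 1)) (T.isClosed_C (j + 1)) (T.C j) (T.isClosed_C j) := by
  obtain ⟨-, h1irr, h1nt, h1pts⟩ := curveData_projDir hPa hx hC0 he
  rw [← hC1] at h1irr h1nt h1pts
  exact inducesIsoOn_of_centres_eq_nearLocus_keyed h314pt h314 h314f h36 h3104 hkey hperm hcl hx hchar hē hC0 hCq h1irr h1nt
    (fun y hy hgy => h1pts y hy hgy) hniso

/-- **(Dich)/(RegN) ALONG THE UNIT, KEYED WITH P-a** — at every stage `1 ≤ j ≤ q` of such a tower the near locus `N_{j+1}(x)` is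
irreducible-or-finite, and regular if infinite (stub-1's (R5) inputs at stage `j + 1` from the centre discipline at stages `≤ j`).
[cite: CossartJannsenSaito2020, Def. 6.38 (iii)–(iv), p. 94, p. 104] -/
theorem dich_and_regN_of_centres_eq_nearLocus_projDir [IsNoetherian (T.X 0)] (hPa : ProjDir_projLine.{u})
    (h314pt : Thm314_point_locus.{u}) (h314 : CossartJannsenSaito2020_thm_3_14.{u}) (h314f : Thm314_nearFibre_subsingleton.{u})
    (h36 : CossartJannsenSaito2020_thm_3_6.{u}) (h3104 : CossartJannsenSaito2020_thm_3_10_4.{u}) (hkey : KeySetting T N)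
    (hperm : ∀ j, IdealSheafData.IsPermissible (T.centreIdeal j))
    (hcl : ∀ (j : ℕ) (μ : ℕ → ℕ), IsClosed (Scheme.hsStratumGE (T.X j) N μ))
    {x : T.X 0} (hx : IsClosed ({x} : Set (T.X 0))) (hchar : CharHypothesis (T.X 0) x) (he : T.dirDimAt 0 x = 2)
    (hē : T.geomDirDimAt 0 x ≤ 2) (hC0 : T.C 0 = {x}) (hC1 : T.C 1 = T.projDir x) {q : ℕ}
    (hCq : ∀ i, 1 ≤ i → i ≤ q → T.C i = T.nearLocus N x i)
    (hniso : ∀ i, 2 ≤ i → i ≤ q → ∃ z ∈ T.nearLocus N x i, IsClosed ({z} : Set (T.X i)) ∧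
      ¬ ∃ U : Set (T.X i), IsOpen U ∧ U ∩ T.nearLocus N x i = {z})
    {j : ℕ} (hj : 1 ≤ j) (hjq : j ≤ q) :
    (IsIrreducible (T.nearLocus N x (j + 1)) ∨ (T.nearLocus N x (j + 1)).Finite) ∧
      ∀ (hN : IsClosed (T.nearLocus N x (j + 1))), (T.nearLocus N x (j + 1)).Infinite →
        Scheme.IsRegular (vanishingIdeal (⟨T.nearLocus N x (j + 1), hN⟩ : Closeds (T.X (j + 1)))).subscheme := by
  obtain ⟨-, h1irr, h1nt, h1pts⟩ := curveData_projDir hPa hx hC0 he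
  rw [← hC1] at h1irr h1nt h1pts
  have hNC : ∀ k, k ≤ j → T.nearLocus N x k ⊆ T.C k := by
    intro k hk
    rcases Nat.eq_zero_or_pos k with rfl | hpos
    · rw [BlowupTower.nearLocus_zero, hC0]
    · exact (hCq k hpos (by omega)).symm.subset
  obtain ⟨hirr, hnt, hpts⟩ := curveData_of_centres_eq_nearLocus h314f h36 h3104 hkey hperm hcl hx hchar hē hC0 hCq h1irr h1nt
    (fun y hy hgy => h1pts y hy hgy) hniso j hj hjq
  have hCN : T.C j ⊆ T.nearLocus N x j := (hCq j hj hjq).subset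
  exact ⟨isIrreducible_or_finite_nearLocus_succ h314f h36 h3104 hkey hperm hcl hx hchar hē hNC hCN hirr hnt hpts,
    fun hN hinf => isRegular_nearLocus_succ_of_infinite h314pt h314 h314f h36 h3104 hkey hperm hcl hx hchar hē hNC hCN hirr hnt
      hpts hinf hN⟩

end BlowupTowerNear

end Summit.ResolutionOfSingularities.ResolutionOfSingularities.Theorems.SigmaMaxModificationsCorridor3.Helpers

end
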